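/-
Copyright (c) 2026 the pub-hodgecm-mathlib formalisation cell (harness21).  Prover seat hodgecm-mathlib-K2Liu-p05 (g4), 2026-09-04
(Track B «K2-LIT», crux hLiu418 = stmt-HodgeConjecture-24832, LEAD F0P6-plan (g13) RULING M-157m (1) organ (SD-1-ind), file (IV-a):
the COFACTOR EXPANSION — a polynomial in the entries of `(1 ± ib)⁻¹` times `det(1 − ib)^{−A} det(1 + ib)^{−B}` is a finite sum of polynomials in the
entries of `b` times INTEGER-SHIFTED powers `det(1 − ib)^{−(A+m)} det(1 + ib)^{−(B+n)}`).
-/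
import Summits.HodgeConjecture.HodgeConjecture.Theorems.K2LiuWeylTranslateIwasawa      -- ★ (SD-1-ind) (I): `isUnit_det_one_{add,sub}_I_smul`
import HarnessLib

/-!
# (SD-1-ind, IV-a) The cofactor expansion: `Q((1+ib)⁻¹, (1−ib)⁻¹)·det(1−ib)^{−A}det(1+ib)^{−B} = Σ_d P_d(b)·det(1−ib)^{−(A+m_d)}det(1+ib)^{−(B+n_d)}`

Track B ∕ K2-LIT, hLiu418 = stmt-HodgeConjecture-24832; LEAD F0P6-plan (g13) RULING M-157m (1) «positive-power entries = `det ×` cofactor; modulus =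
(α, β) shifts».  Namespace `Summit.HodgeConjecture.HodgeConjecture.Cruxes.HLiu418.K2LiuInverseLettersCofactorExpansion`.  THEOREMS ONLY (no definition,
no instance, no notation, no named fact, no `sorry`); generic index type `l`; `--supports stmt-HodgeConjecture-24832 --as helper`.

THE STATEMENT (`exists_cofactor_expansion`).  For every `Q ∈ ℂ[X_{jk}, Y_{jk}]` there are polynomials `P_d ∈ ℂ[b_{jk}]` and integers `m_d, n_d ≥ 0`,
indexed by the monomials `d` of `Q`, such that for every hermitian `b` and all `A, B ∈ ℂ`
  `Q((1 + ib)⁻¹_{jk}, (1 − ib)⁻¹_{jk}) · det(1 − ib)^{−A} · det(1 + ib)^{−B} = Σ_{d ∈ supp Q} P_d(b_{jk}) · det(1 − ib)^{−(A + m_d)} · det(1 + ib)^{−(B + n_d)}`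
(principal powers; `det(1 ± ib) ≠ 0` by ★ (I)).  PROOF: `M⁻¹ = (det M)⁻¹ · adj M` (`Matrix.inv_def`) with `adj(1 ± ib)` a polynomial matrix in `b`
(`RingHom.map_adjugate`), so a monomial of bidegree `(n, m)` in `((1+ib)⁻¹, (1−ib)⁻¹)` is `(adjugate monomial)(b) · det(1+ib)^{−n} det(1−ib)^{−m}`, and
`z⁻ᵐ · z^{−A} = z^{−(A+m)}` (`Complex.cpow_add`, `cpow_natCast`).
USE ((SD-1-ind) (IV-b)∕(V)): with ★ (III) `exists_mvPolynomial_section_J_mul_transl` and `χ = χ_k`, `f (J · transl x) e(−tr hx)` becomes a finite sum of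
POLYNOMIAL `x`-moments of Shimura's `ξ`-integrands `xiTwoIntegrand 1 h (A + m_d) (B + n_d)` (K2E5-p16 (g5)'s ★ `K2LiuHermTwoConfluentXiDefs`).

HONEST LABEL: HC_CM is proved only modulo the 7 printed citations (2 remaining named inputs: hLiu418 = stmt-HodgeConjecture-24832, h413 =
stmt-HodgeConjecture-24833) until rung 0 closes; organ capital, moves no counter.

## References
[Shimura1997] G. Shimura, *Euler Products and Eisenstein Series*, CBMS 93 (1997), §16 · G. Shimura, *Confluent hypergeometric functions on tube domains*,
Math. Ann. 260 (1982), §3 (polynomial sections and shifted parameters).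
-/

set_option autoImplicit false
set_option linter.dupNamespace false

noncomputable section

open scoped Matrix ComplexConjugate ComplexOrder MatrixOrder
open Complex Matrix
open Summit.HodgeConjecture.HodgeConjecture.Cruxes.HLiu418.K2LiuWeylTranslateIwasawa

namespace Summit.HodgeConjecture.HodgeConjecture.Cruxes.HLiu418.K2LiuInverseLettersCofactorExpansion

variable {l : Type*} [Fintype l] [DecidableEq l]

/-! ## §1 Scalar bookkeeping: `z⁻ᵐ · z^{−A} = z^{−(A + m)}` -/

/-- `z⁻¹ ^ m * z ^ (−A) = z ^ (−(A + m))` for `z ≠ 0` (principal powers). [folklore] -/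
theorem inv_pow_mul_cpow_neg {z : ℂ} (hz : z ≠ 0) (A : ℂ) (m : ℕ) : z⁻¹ ^ m * z ^ (-A) = z ^ (-(A + m)) := by
  rw [neg_add, cpow_add _ _ hz, cpow_neg z (m : ℂ), cpow_natCast, inv_pow, mul_comm]

/-! ## §2 The entries of `(1 ± ib)⁻¹` are `det⁻¹ ×` polynomial cofactors -/

omit [Fintype l] in
/-- the polynomial matrix `1 + i X` evaluates to `1 + ib`. [folklore] -/
theorem map_one_add (b : Matrix l l ℂ) :
    (1 + Matrix.of fun j k => MvPolynomial.C I * MvPolynomial.X (j, k) : Matrix l l (MvPolynomial (l × l) ℂ)).map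
        (MvPolynomial.eval fun jk : l × l => b jk.1 jk.2) = 1 + I • b := by
  ext j k
  rw [Matrix.map_apply, Matrix.add_apply, Matrix.add_apply, map_add, Matrix.of_apply, map_mul, MvPolynomial.eval_C,
    MvPolynomial.eval_X, Matrix.smul_apply, smul_eq_mul, Matrix.one_apply, Matrix.one_apply]
  split_ifs <;> simp

omit [Fintype l] in
/-- the polynomial matrix `1 − i X` evaluates to `1 − ib`. [folklore] -/
theorem map_one_sub (b : Matrix l l ℂ) :
    (1 - Matrix.of fun j k => MvPolynomial.C I * MvPolynomial.X (j, k) : Matrix l l (MvPolynomial (l × l) ℂ)).map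
        (MvPolynomial.eval fun jk : l × l => b jk.1 jk.2) = 1 - I • b := by
  ext j k
  rw [Matrix.map_apply, Matrix.sub_apply, Matrix.sub_apply, map_sub, Matrix.of_apply, map_mul, MvPolynomial.eval_C,
    MvPolynomial.eval_X, Matrix.smul_apply, smul_eq_mul, Matrix.one_apply, Matrix.one_apply]
  split_ifs <;> simp

/-- **`(1 + ib)⁻¹_{jk} = det(1 + ib)⁻¹ · adj(1 + iX)_{jk}(b)`**. [folklore] -/
theorem inv_one_add_apply (b : Matrix l l ℂ) (j k : l) :
    (1 + I • b)⁻¹ j k = ((1 + I • b).det)⁻¹ *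
      MvPolynomial.eval (fun jk : l × l => b jk.1 jk.2)
        ((1 + Matrix.of fun j k => MvPolynomial.C I * MvPolynomial.X (j, k) : Matrix l l (MvPolynomial (l × l) ℂ)).adjugate j k) := by
  rw [Matrix.inv_def, Ring.inverse_eq_inv', Matrix.smul_apply, smul_eq_mul]
  congr 1
  have h := RingHom.map_adjugate (MvPolynomial.eval fun jk : l × l => b jk.1 jk.2)
    (1 + Matrix.of fun j k => MvPolynomial.C I * MvPolynomial.X (j, k) : Matrix l l (MvPolynomial (l × l) ℂ))
  rw [RingHom.mapMatrix_apply, RingHom.mapMatrix_apply, map_one_add] at h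
  rw [← h, Matrix.map_apply]

/-- **`(1 − ib)⁻¹_{jk} = det(1 − ib)⁻¹ · adj(1 − iX)_{jk}(b)`**. [folklore] -/
theorem inv_one_sub_apply (b : Matrix l l ℂ) (j k : l) :
    (1 - I • b)⁻¹ j k = ((1 - I • b).det)⁻¹ *
      MvPolynomial.eval (fun jk : l × l => b jk.1 jk.2)
        ((1 - Matrix.of fun j k => MvPolynomial.C I * MvPolynomial.X (j, k) : Matrix l l (MvPolynomial (l × l) ℂ)).adjugate j k) := by
  rw [Matrix.inv_def, Ring.inverse_eq_inv', Matrix.smul_apply, smul_eq_mul]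
  congr 1
  have h := RingHom.map_adjugate (MvPolynomial.eval fun jk : l × l => b jk.1 jk.2)
    (1 - Matrix.of fun j k => MvPolynomial.C I * MvPolynomial.X (j, k) : Matrix l l (MvPolynomial (l × l) ℂ))
  rw [RingHom.mapMatrix_apply, RingHom.mapMatrix_apply, map_one_sub] at h
  rw [← h, Matrix.map_apply]

/-! ## §3 The cofactor expansion -/

/-- **THE COFACTOR EXPANSION.**  For every polynomial `Q` in the entries of `(1 + ib)⁻¹` (variables `inl`) and `(1 − ib)⁻¹` (variables `inr`) there are
polynomials `P_d` in the entries of `b` and shifts `m_d, n_d ∈ ℕ` (`m_d` = the `inr`-degree, `n_d` = the `inl`-degree of the monomial `d`) with, for all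
hermitian `b` and all `A, B ∈ ℂ`,
`Q(…)·det(1 − ib)^{−A}·det(1 + ib)^{−B} = Σ_{d ∈ supp Q} P_d(b)·det(1 − ib)^{−(A + m_d)}·det(1 + ib)^{−(B + n_d)}`. [cite: Shimura1997, §16.4] -/
theorem exists_cofactor_expansion (Q : MvPolynomial ((l × l) ⊕ (l × l)) ℂ) :
    ∃ (P : (((l × l) ⊕ (l × l)) →₀ ℕ) → MvPolynomial (l × l) ℂ) (m n : (((l × l) ⊕ (l × l)) →₀ ℕ) → ℕ),
      ∀ b : Matrix l l ℂ, bᴴ = b → ∀ A B : ℂ,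
        MvPolynomial.eval (Sum.elim (fun jk : l × l => (1 + I • b)⁻¹ jk.1 jk.2) (fun jk : l × l => (1 - I • b)⁻¹ jk.1 jk.2)) Q *
            ((1 - I • b).det ^ (-A) * (1 + I • b).det ^ (-B)) =
          ∑ d ∈ Q.support, MvPolynomial.eval (fun jk : l × l => b jk.1 jk.2) (P d) *
            ((1 - I • b).det ^ (-(A + m d)) * (1 + I • b).det ^ (-(B + n d))) := by
  classical
  -- the adjugate polynomials of the two letters
  let adjPoly : (l × l) ⊕ (l × l) → MvPolynomial (l × l) ℂ :=
    Sum.elim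
      (fun jk => (1 + Matrix.of fun j k => MvPolynomial.C I * MvPolynomial.X (j, k) : Matrix l l (MvPolynomial (l × l) ℂ)).adjugate jk.1 jk.2)
      (fun jk => (1 - Matrix.of fun j k => MvPolynomial.C I * MvPolynomial.X (j, k) : Matrix l l (MvPolynomial (l × l) ℂ)).adjugate jk.1 jk.2)
  refine ⟨fun d => MvPolynomial.C (Q.coeff d) * ∏ i ∈ d.support, adjPoly i ^ d i,
    fun d => ∑ i ∈ d.support, Sum.elim (fun _ : l × l => 0) (fun _ : l × l => d i) i,
    fun d => ∑ i ∈ d.support, Sum.elim (fun _ : l × l => d i) (fun _ : l × l => 0) i, ?_⟩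
  intro b hb A B
  have hP : (1 + I • b).det ≠ 0 := (isUnit_det_one_add_I_smul hb).ne_zero
  have hM : (1 - I • b).det ≠ 0 := (isUnit_det_one_sub_I_smul hb).ne_zero
  -- each letter entry = (det-inverse, to the power 1 or 0) × (adjugate polynomial at `b`)
  have hval : ∀ i : (l × l) ⊕ (l × l),
      Sum.elim (fun jk : l × l => (1 + I • b)⁻¹ jk.1 jk.2) (fun jk : l × l => (1 - I • b)⁻¹ jk.1 jk.2) i =
        ((1 + I • b).det)⁻¹ ^ (Sum.elim (fun _ : l × l => 1) (fun _ : l × l => 0) i : ℕ) *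
          ((1 - I • b).det)⁻¹ ^ (Sum.elim (fun _ : l × l => 0) (fun _ : l × l => 1) i : ℕ) *
            MvPolynomial.eval (fun jk : l × l => b jk.1 jk.2) (adjPoly i) := by
    rintro (jk | jk)
    · simp only [Sum.elim_inl, pow_one, pow_zero, mul_one, adjPoly]
      exact inv_one_add_apply b jk.1 jk.2
    · simp only [Sum.elim_inr, pow_one, pow_zero, one_mul, adjPoly]
      exact inv_one_sub_apply b jk.1 jk.2
  rw [MvPolynomial.eval_eq, Finset.sum_mul]
  refine Finset.sum_congr rfl fun d _ => ?_
  -- the monomial `d`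
  have hprod : ∏ i ∈ d.support, Sum.elim (fun jk : l × l => (1 + I • b)⁻¹ jk.1 jk.2) (fun jk : l × l => (1 - I • b)⁻¹ jk.1 jk.2) i ^ d i =
      ((1 + I • b).det)⁻¹ ^ (∑ i ∈ d.support, Sum.elim (fun _ : l × l => d i) (fun _ : l × l => 0) i) *
        ((1 - I • b).det)⁻¹ ^ (∑ i ∈ d.support, Sum.elim (fun _ : l × l => 0) (fun _ : l × l => d i) i) *
          ∏ i ∈ d.support, MvPolynomial.eval (fun jk : l × l => b jk.1 jk.2) (adjPoly i) ^ d i := by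
    simp_rw [hval, mul_pow, Finset.prod_mul_distrib, ← pow_mul, Finset.prod_pow_eq_pow_sum]
    congr 3
    · exact Finset.sum_congr rfl (by rintro (jk | jk) _ <;> simp)
    · exact Finset.sum_congr rfl (by rintro (jk | jk) _ <;> simp)
  rw [hprod, map_mul, MvPolynomial.eval_C, map_prod]
  simp_rw [map_pow]
  rw [← inv_pow_mul_cpow_neg hM A, ← inv_pow_mul_cpow_neg hP B]
  ring

end Summit.HodgeConjecture.HodgeConjecture.Cruxes.HLiu418.K2LiuInverseLettersCofactorExpansion

end
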